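import Literature.AlgebraicGeometry.AbelianVarieties.PoincareSheafFibrewisePicZero
import Literature.AlgebraicGeometry.AbelianSchemes.AbelianSchemeIsLambdaOfAtConjugateTransport
import Literature.AlgebraicGeometry.Modules.DetClassOfIso
import HarnessLib

/-!
# The polarisation `φ_Θ : A → Â` of a complex abelian variety with respect to ANY dual pair
# ([MFK94] Def. 6.2–6.3 «`λ̄ = Λ(L̄)` at all geometric points»; [Mumford AV] §8, §13; Milne AV I §8)

Layer `Literature/AlgebraicGeometry/AbelianVarieties`, namespace `Literature.AlgebraicGeometry.AbelianVarieties`.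
THEOREMS ONLY (no definition, no named fact, no instance, no `sorry`).  Cell `hodgecm-mathlib` (D-0151), U-DAG §2 node
U-a4 «`Polarization` of `ofAbelianVariety A₀` from `Θ` GIVEN the dual pair» (B-plan2 (g10) GO (F1), hand B-p18 (g14));
census `B-plan/probes/Ua4-PolarizationOfSiegelTorus.census.B-p18g14.md`.  HC_CM is proved only modulo the printed
citations until rung 0 closes.

Setting: a complex abelian variety `A₀`, an ample Cartier divisor `Θ`, the abelian scheme `A := ofAbelianVariety A₀`
over `Spec ℂ`, and a dual pair `D : A.DualPair` (★ D2 `AbelianSchemes/AbelianSchemeDualPair`) PRESENTED BY the output of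
the cell's U-a3 statement: an isomorphism of group schemes `e : D.hat.X ≅ (ofAbelianVariety (A₀/K(Θ))).X` and an
isomorphism `(1 × (φ_Θ ≫ e⁻¹))^*𝒫 ≅ Λ(𝒪(Θ))` (★ `mumfordSheaf`).  We prove:

* `isMonHom_phiTheta_comp_inv` — `λ := φ_Θ ≫ e⁻¹ : A → D.hat` is a homomorphism;
* `phiTheta_comp_inv_comp_hom` — it lies over `Spec ℂ` (the proof term the U-a3 statement uses to form `1 × λ`);
* **`isLambdaOfAt_of_cechClass_eq`** — [MFK94] Def. 6.2 AT EVERY FIELD-VALUED POINT `s : Spec Ω → Spec ℂ`: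
  `λ̄ = Λ(𝒪(Θ_s))` (the tree's `IsLambdaOfAt s D λ Θ_s`) for every divisor `Θ_s` on the fibre `A_s` whose class is
  `pr₁^*[Θ]`.  Proof: present `s = Spec σ`, so that `A_s` IS `A₀ ×_{ℂ,σ} Ω` (★ `AlongHom`); the D2 slice of `A_s` at
  `λ̄(P′)` is `(pr₁, a_{P′} ∘ pr₂) ≫ (1 × λ)`, hence its class is the class of `Λ(𝒪(Θ))|_{A_Ω × {a_{P′}}}`, which is
  `t_{P′}^*(pr₁^*[Θ])·(pr₁^*[Θ])⁻¹` by ★ `cechPic_pullback_slice_mk_mumfordCocycle` ([Mumford AV] §8 at a point rational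
  over the extension), i.e. the class of `t_{P′}^*𝒪(Θ_s) ⊗ 𝒪(Θ_s)⁻¹` (★ `detClass_translationPullback_tensor_dual`);
  two rank-one modules with the same class are isomorphic (★ `nonempty_iso_iff_detClass_eq`);
* `exists_isAmple_cechClass_eq_fibre` — on every fibre `pr₁^*Θ` is such a divisor and is ample (`pr₁` is a base change
  of `Spec Ω → Spec ℂ`: dominant and affine; ★ `CartierDivisor.IsAmple.pullback`);
* **`exists_polarization_of_dualPair`** — HEAD: `∃ pol : A.Polarization D` with `pol.lam = φ_Θ ≫ e⁻¹`, together with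
  the identity-fibre witness `∃ Θ₁` (ample, `IsLambdaOfAt (𝟙 _) D pol.lam Θ₁`, `[Θ₁] = pr₁^*[Θ]`) that the cell's
  consumers take by name (★ `IsAdmissibleAt`, ★ `exists_isAdmissibleAt_of_normalFormFrame`, the symplectic-lift leaf).

Design notes.  (1) Everything is spelt through `ofAbelianVariety A₀` (D2's `pullback A.X.hom _` currency); the monoidal
spelling `(A₀.X ⊗ _).left` of ★ `PoincareSheaf*` agrees with it by `rfl` but not at instances transparency, so seams are
closed by `Eq.trans`/`congrArg` chains and `φ_Θ.hom.hom.hom` is generalised to an opaque `φ` (★ `PoincareSheafSlices`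
trick).  (2) The identity-fibre witness is exported CLASS-LEVEL (`∃ Θ₁ … ∧ [Θ₁] = pr₁^*[Θ]`) rather than as
`Θ.pullback pr₁`, because `CartierDivisor.pullback` in a STATEMENT needs an `IsDominant` instance that typeclass search
finds only for the `pullback`-spelt projection while `IsIntegral` is found only for the fibre-spelt one.  What is NOT
here: the type clause `pol.HasType δ` for the algebraised Siegel torus (node U-a4 (Q4), a separate leaf over ★
`SiegelLevelDModuli.levelDPoint` + ★ `AbelianVarietyPolarizationTypeAnalytic`), and U-a3 itself (the dual pair is a
HYPOTHESIS here).

## References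
* [MumfordFogartyKirwan1994] D. Mumford, J. Fogarty, F. Kirwan, *Geometric Invariant Theory*, 3rd ed. (1994), Ch. 6 §2
  Definition 6.2 (`Λ(L)(x) = T_x^*L ⊗ L⁻¹`) and Definition 6.3 (polarisation; p. 120).
* [MumfordAV1970] D. Mumford, *Abelian Varieties* (1970), §8 pp. 74–80 («`P|_{X × {φ_L(a)}} ≅ T_a^*L ⊗ L⁻¹`»), §13 p. 125.
* [MilneAV2008] J. S. Milne, *Abelian Varieties* (2008), I §8 pp. 36–40 (the dual pair; `λ_L`).
* [GortzWedhorn2020] U. Görtz, T. Wedhorn, *Algebraic Geometry I*, 2nd ed. (2020), Section (4.7) (base change, points of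
  `X ×_k L`), Prop. 13.66 (2) (pull-back of ample along affine morphisms).
-/

set_option autoImplicit false

open CategoryTheory CategoryTheory.Limits AlgebraicGeometry MonoidalCategory CartesianMonoidalCategory Opposite
open Literature.AlgebraicGeometry.Motives Literature.AlgebraicGeometry.Modules
open Literature.AlgebraicGeometry.AbelianSchemes
open scoped MonObj

noncomputable section

namespace Literature.AlgebraicGeometry.AbelianVarieties

variable (A₀ : AbelianVariety ℂ) {Θ : CartierDivisor A₀.X.left} (hΘ : Θ.IsAmple)
  (D : (AbelianSchemeOver.ofAbelianVariety A₀).DualPair)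
  (e : D.hat.X ≅ (AbelianSchemeOver.ofAbelianVariety (A₀.dualOf Θ hΘ)).X)

/-! ### §1 `λ := φ_Θ ≫ e⁻¹` is a homomorphism over `Spec ℂ` -/

/-- **`λ = φ_Θ ≫ e⁻¹ : A → D.hat` is a homomorphism of `Spec ℂ`-group schemes** (`φ_Θ` is a morphism of abelian
varieties — Mathlib `Grp.Hom.isMonHom_hom` —, `e⁻¹` is the inverse of an isomorphism of group schemes; the composite
instance is supplied explicitly because the two `MonObj` structures on `A₀.X = (ofAbelianVariety A₀).X` agree by `rfl`
only). [cite: MumfordFogartyKirwan1994, Ch. 6 §2 Definition 6.3 (p. 120)] [cite: MilneAV2008, I §8 p. 36] -/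
theorem isMonHom_phiTheta_comp_inv (he : IsMonHom e.hom) :
    IsMonHom ((A₀.phiTheta Θ hΘ).hom.hom.hom ≫ e.inv) := by
  haveI := he
  have h2 : IsMonHom e.inv := by
    haveI : IsMonHom e.symm.hom := by change IsMonHom e.inv; infer_instance
    exact this
  have h1 : IsMonHom (A₀.phiTheta Θ hΘ).hom.hom.hom := (A₀.phiTheta Θ hΘ).hom.hom.isMonHom_hom
  exact @instIsMonHomComp _ _ _ _ _ _ _ _ _ (A₀.phiTheta Θ hΘ).hom.hom.hom e.inv h1 h2

/-- The structure-map identity `(φ_Θ ≫ e⁻¹) ≫ π_{D.hat} = π_A` needed to form `1_A × (φ_Θ ≫ e⁻¹)` (the proof term of the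
cell's U-a3 statement, so that its `eP` binder is literally the one below). [cite: MilneAV2008, I §8 pp. 36–37] -/
theorem phiTheta_comp_inv_comp_hom :
    (AbelianVariety.Hom.toSchemeHom (A₀.phiTheta Θ hΘ) ≫ e.inv.left) ≫ D.hat.X.hom = A₀.X.hom := by
  rw [Category.assoc]
  exact (congrArg (AbelianVariety.Hom.toSchemeHom (A₀.phiTheta Θ hΘ) ≫ ·) (Over.w e.inv)).trans
    (Over.w (A₀.phiTheta Θ hΘ).hom.hom.hom)

variable (eP : Nonempty (D.pullbackP A₀.X.hom (AbelianVariety.Hom.toSchemeHom (A₀.phiTheta Θ hΘ) ≫ e.inv.left)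
    (phiTheta_comp_inv_comp_hom A₀ hΘ D e) ≅ mumfordSheaf A₀ Θ))

/-! ### §2 [MFK94] Def. 6.2 at every field-valued point `s : Spec Ω → Spec ℂ` -/

section GeomPoint

open AbelianSchemeOver in
include eP in
/-- **`λ̄ = Λ(𝒪(Θ_s))` AT EVERY FIELD-VALUED POINT `s : Spec Ω → Spec ℂ`** for every divisor `Θ_s` on the fibre
`A_s = A ×_ℂ Spec Ω` with `[Θ_s] = pr₁^*[Θ]`: present `s = Spec σ`; then `A_s` is `A_L`, `L = Ω` via `σ`
(★ `AlongHom`), the slice of D2 at `λ̄(P′)` is `(pr₁, a_{P′} ∘ pr₂) ≫ (1 × (φ_Θ ≫ e⁻¹))`, so its class is the class of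
`Λ(𝒪(Θ))|_{A_L × {a_{P′}}}` = `t_{P′}^*(pr₁^*[Θ])·(pr₁^*[Θ])⁻¹` (★ `cechPic_pullback_slice_mk_mumfordCocycle`,
[MumfordAV1970] §8 at an `L`-rational point), which is the class of `t_{P′}^*𝒪(Θ_s) ⊗ 𝒪(Θ_s)⁻¹`
(★ `detClass_translationPullback_tensor_dual`); rank-one modules with equal classes are isomorphic.
[cite: MumfordFogartyKirwan1994, Ch. 6 §2 Definition 6.2 (p. 120)] [cite: MumfordAV1970, §8 (pp. 78–80)]
[cite: GortzWedhorn2020, Section (4.7)] -/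
theorem isLambdaOfAt_of_cechClass_eq (lam : (AbelianSchemeOver.ofAbelianVariety A₀).X ⟶ D.hat.X)
    (hlam : lam = (A₀.phiTheta Θ hΘ).hom.hom.hom ≫ e.inv)
    {Ω : Type} [Field Ω] (s : Spec (CommRingCat.of Ω) ⟶ Spec (CommRingCat.of ℂ))
    (Θs : CartierDivisor (((ofAbelianVariety A₀).fibre s).toAbelianVariety).X.left)
    (hΘs : Θs.cechClass = CechPic.pullback (pullback.fst (ofAbelianVariety A₀).X.hom s) Θ.cechClass) :
    (ofAbelianVariety A₀).IsLambdaOfAt s D lam Θs := by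
  obtain ⟨σ, rfl⟩ : ∃ σ : ℂ →+* Ω, Spec.map (CommRingCat.ofHom σ) = s :=
    ⟨(Spec.preimage s).hom, Spec.map_preimage s⟩
  obtain ⟨φ, hφ⟩ : ∃ φ : (ofAbelianVariety A₀).X ⟶ (ofAbelianVariety (A₀.dualOf Θ hΘ)).X,
      φ = (A₀.phiTheta Θ hΘ).hom.hom.hom := ⟨_, rfl⟩
  have hlam' : lam = φ ≫ e.inv := by
    rw [hlam, hφ]
    rfl
  intro P'
  -- `A_s` is `A_L` for `L = Ω` through `σ`; the point `P'` as an `L`-point of `A_L`, and the `A`-point under it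
  let Pb : (A₀.baseChange (AlongHom Ω σ)).Points (AlongHom Ω σ) := P'
  let a : A₀.Points (AlongHom Ω σ) := (A₀.pointsEquiv (AlongHom Ω σ)).symm Pb
  have ha : a.left = P'.left ≫ pullback.fst (ofAbelianVariety A₀).X.hom (Spec.map (CommRingCat.ofHom σ)) :=
    A₀.pointsEquiv_symm_apply_left (AlongHom Ω σ) Pb
  -- the slice `G = (pr₁, a ∘ pr₂) : A_L → A × A`
  let G : pullback (ofAbelianVariety A₀).X.hom (Spec.map (CommRingCat.ofHom σ)) ⟶
      pullback (ofAbelianVariety A₀).X.hom A₀.X.hom :=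
    pullback.lift (pullback.fst _ _)
      (pullback.snd _ _ ≫ (ofAbelianVariety A₀).fibrePointToLeft (Spec.map (CommRingCat.ofHom σ)) P')
      (by
        rw [Category.assoc]
        erw [fibrePointToLeft_comp_hom]
        exact pullback.condition)
  have hG₁ : G ≫ pullback.fst _ _ = pullback.fst _ _ := pullback.lift_fst _ _ _
  have hG₂ : G ≫ pullback.snd _ _ =
      pullback.snd _ _ ≫ (ofAbelianVariety A₀).fibrePointToLeft (Spec.map (CommRingCat.ofHom σ)) P' :=
    pullback.lift_snd _ _ _
  -- D2's slice at `λ̄(P')` is `G ≫ (1 × (φ_Θ ≫ e⁻¹))`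
  have hsl : (ofAbelianVariety A₀).sliceAt _ D lam P' =
      G ≫ (ofAbelianVariety A₀).baseChangeToProd D.hat A₀.X.hom
        (AbelianVariety.Hom.toSchemeHom (A₀.phiTheta Θ hΘ) ≫ e.inv.left) (phiTheta_comp_inv_comp_hom A₀ hΘ D e) := by
    have hb1 := (ofAbelianVariety A₀).baseChangeToProd_fst D.hat A₀.X.hom
      (AbelianVariety.Hom.toSchemeHom (A₀.phiTheta Θ hΘ) ≫ e.inv.left) (phiTheta_comp_inv_comp_hom A₀ hΘ D e)
    have hb2 := (ofAbelianVariety A₀).baseChangeToProd_snd D.hat A₀.X.hom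
      (AbelianVariety.Hom.toSchemeHom (A₀.phiTheta Θ hΘ) ≫ e.inv.left) (phiTheta_comp_inv_comp_hom A₀ hΘ D e)
    apply pullback.hom_ext
    · refine ((ofAbelianVariety A₀).sliceAt_fst _ D _ P').trans ?_
      exact (hG₁.symm.trans (congrArg (G ≫ ·) hb1).symm).trans (Category.assoc _ _ _).symm
    · refine ((ofAbelianVariety A₀).sliceAt_snd _ D _ P').trans ?_
      rw [AbelianSchemeOver.valueAt, hlam']
      refine Eq.trans ?_ (Category.assoc _ _ _).symm
      refine Eq.trans ?_ (congrArg (G ≫ ·) hb2).symm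
      refine Eq.trans ?_ (Category.assoc _ _ _)
      refine Eq.trans ?_ (congrArg (· ≫ (AbelianVariety.Hom.toSchemeHom (A₀.phiTheta Θ hΘ) ≫ e.inv.left)) hG₂).symm
      refine Eq.trans ?_ (Category.assoc _ _ _).symm
      rw [hφ]
      rfl
  -- ranks / witnesses
  have hW : IsFiniteLocallyFree ((Scheme.Modules.pullback
      ((ofAbelianVariety A₀).sliceAt _ D lam P')).obj D.P) :=
    (HasRank.isFiniteLocallyFree' D.hasRank_one).pullback _
  have hr : HasRank (tensorObj
      ((Scheme.Modules.pullback (((ofAbelianVariety A₀).fibre _).toAbelianVariety.translation P').left).obj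
        ((ofAbelianVariety A₀).lineBundleOfDivisor _ Θs))
      (Modules.dual ((ofAbelianVariety A₀).lineBundleOfDivisor _ Θs))) 1 :=
    hasRank_tensorObj_one (hasRank_pullback _ ((ofAbelianVariety A₀).hasRank_lineBundleOfDivisor _ _))
      (hasRank_dual ((ofAbelianVariety A₀).hasRank_lineBundleOfDivisor _ _))
  have hfl := HasRank.isFiniteLocallyFree' hr
  refine (nonempty_iso_iff_detClass_eq (hasRank_pullback _ D.hasRank_one) hr hW hfl).mpr ?_
  -- the class of the slice is the class of `Λ(𝒪(Θ))|_{A_L × {a}}`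
  obtain ⟨i⟩ := eP
  have j : (Scheme.Modules.pullback ((ofAbelianVariety A₀).sliceAt _ D lam P')).obj D.P ≅
      (Scheme.Modules.pullback G).obj (mumfordSheaf A₀ Θ) :=
    (Scheme.Modules.pullbackCongr hsl).app D.P ≪≫ ((Scheme.Modules.pullbackComp G _).app D.P).symm ≪≫
      (Scheme.Modules.pullback G).mapIso i
  have h1 : detClass hW = CechPic.pullback G (CechPic.mk (mumfordCocycle A₀ Θ)) :=
    ((detClass_eq_of_iso j hW ((isFiniteLocallyFree_mumfordSheaf A₀ Θ).pullback G)).trans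
      (detClass_pullback G (isFiniteLocallyFree_mumfordSheaf A₀ Θ))).trans
      (congrArg (CechPic.pullback G) (mumfordCocycle A₀ Θ).detClass_lineBundle)
  have h2 := cechPic_pullback_slice_mk_mumfordCocycle (AlongHom Ω σ) A₀ Θ a
    (pullback.fst A₀.X.hom (AbelianVariety.bcSpec ℂ (AlongHom Ω σ))) rfl G hG₁ (hG₂.trans (by rw [ha]; rfl))
  refine (h1.trans h2).trans (Eq.trans ?_
    ((ofAbelianVariety A₀).detClass_translationPullback_tensor_dual _ Θs P' hfl).symm)
  rw [hΘs, AbelianVariety.pointsMulEquiv_apply, Equiv.apply_symm_apply]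
  rfl

end GeomPoint

/-! ### §3 The divisor `pr₁^*Θ` on each fibre -/

section Fibre

open AbelianSchemeOver in
include hΘ in
/-- **On every fibre `A_s` (`s : Spec Ω → Spec ℂ`) there is an AMPLE divisor with class `pr₁^*[Θ]`**, namely
`pr₁^*Θ` (`pr₁ : A_s → A` is dominant and affine, being a base change of `Spec Ω → Spec ℂ`; ★
`CartierDivisor.IsAmple.pullback`, ★ `CartierDivisor.cechClass_pullback`).
[cite: GortzWedhorn2020, Prop. 13.66 (2) (p. 509) and Section (4.7)] -/
theorem exists_isAmple_cechClass_eq_fibre {Ω : Type} [Field Ω] (s : Spec (CommRingCat.of Ω) ⟶ Spec (CommRingCat.of ℂ)) :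
    ∃ Θs : CartierDivisor (((ofAbelianVariety A₀).fibre s).toAbelianVariety).X.left,
      Θs.IsAmple ∧ Θs.cechClass = CechPic.pullback (pullback.fst (ofAbelianVariety A₀).X.hom s) Θ.cechClass := by
  haveI : Surjective s := ⟨fun y => ⟨⟨⊥, Ideal.isPrime_bot⟩, Subsingleton.elim _ _⟩⟩
  have hd : IsDominant (pullback.fst (ofAbelianVariety A₀).X.hom s) := inferInstance
  have haff : IsAffineHom (pullback.fst (ofAbelianVariety A₀).X.hom s) :=
    MorphismProperty.pullback_fst _ _ inferInstance
  haveI : @IsDominant (((ofAbelianVariety A₀).fibre s).toAbelianVariety).X.left A₀.X.left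
      (pullback.fst (ofAbelianVariety A₀).X.hom s) := hd
  haveI : @IsAffineHom (((ofAbelianVariety A₀).fibre s).toAbelianVariety).X.left A₀.X.left
      (pullback.fst (ofAbelianVariety A₀).X.hom s) := haff
  exact ⟨Θ.pullback (pullback.fst (ofAbelianVariety A₀).X.hom s :
      (((ofAbelianVariety A₀).fibre s).toAbelianVariety).X.left ⟶ A₀.X.left),
    hΘ.pullback _, CartierDivisor.cechClass_pullback _ _⟩

end Fibre

end Literature.AlgebraicGeometry.AbelianVarieties

/-! ### §4 HEAD — the polarisation of `(A, Θ)` with respect to ANY dual pair (U-a4 given U-a3) -/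

namespace Literature.AlgebraicGeometry.AbelianVarieties

open AbelianSchemeOver in
/-- **U-a4 GIVEN U-a3: the polarisation `λ = φ_Θ ≫ e⁻¹ : A → Â_D` of [MFK94] Def. 6.3 for a complex abelian variety
`A₀` with an ample divisor `Θ` and ANY dual pair `D` of `A₀/ℂ` presented as `e : D.hat ≅ A₀/K(Θ)` with
`(1 × (φ_Θ ≫ e⁻¹))^*𝒫 ≅ Λ(𝒪(Θ))` (the binders are token-for-token the `∃`-body of the cell's U-a3 statement
`U_a3_dualPair_ofAbelianVariety`).**  There is `pol : (ofAbelianVariety A₀).Polarization D` with `pol.lam = φ_Θ ≫ e⁻¹`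
(a homomorphism; at EVERY geometric point `s : Spec Ω → Spec ℂ` the divisor `pr₁^*Θ` on `A_s` is ample and
`λ̄ = Λ(𝒪(pr₁^*Θ))`, `isLambdaOfAt_of_cechClass_eq`), TOGETHER WITH the identity-fibre witness the cell's consumers take
(`IsAdmissibleAt`, the symplectic-lift leaf, (vi) `exists_isAdmissibleAt_of_normalFormFrame`): an ample `Θ₁` on
`A₁ = A ×_ℂ Spec ℂ` with `λ̄ = Λ(𝒪(Θ₁))` at `𝟙` and `[Θ₁] = pr₁^*[Θ]`.
[cite: MumfordFogartyKirwan1994, Ch. 6 §2 Definition 6.2–6.3 (p. 120)] [cite: MumfordAV1970, §8 (pp. 78–80) and §13 (p. 125)]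
[cite: MilneAV2008, I §8 pp. 36–40] -/
theorem exists_polarization_of_dualPair (A₀ : AbelianVariety ℂ) (Θ : CartierDivisor A₀.X.left) (hΘ : Θ.IsAmple)
    (D : (ofAbelianVariety A₀).DualPair) (e : D.hat.X ≅ (ofAbelianVariety (A₀.dualOf Θ hΘ)).X)
    (he : IsMonHom e.hom)
    (eP : Nonempty (D.pullbackP A₀.X.hom (AbelianVariety.Hom.toSchemeHom (A₀.phiTheta Θ hΘ) ≫ e.inv.left)
      (phiTheta_comp_inv_comp_hom A₀ hΘ D e) ≅ mumfordSheaf A₀ Θ)) :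
    ∃ pol : (ofAbelianVariety A₀).Polarization D,
      pol.lam = (A₀.phiTheta Θ hΘ).hom.hom.hom ≫ e.inv ∧
        ∃ Θ₁ : CartierDivisor (((ofAbelianVariety A₀).fibre (𝟙 (Spec (CommRingCat.of ℂ)))).toAbelianVariety).X.left,
          Θ₁.IsAmple ∧ (ofAbelianVariety A₀).IsLambdaOfAt (𝟙 (Spec (CommRingCat.of ℂ))) D pol.lam Θ₁ ∧
            Θ₁.cechClass = CechPic.pullback
              (pullback.fst (ofAbelianVariety A₀).X.hom (𝟙 (Spec (CommRingCat.of ℂ)))) Θ.cechClass := by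
  obtain ⟨Θ₁, h1, h2⟩ := exists_isAmple_cechClass_eq_fibre A₀ hΘ (𝟙 (Spec (CommRingCat.of ℂ)))
  refine ⟨⟨(A₀.phiTheta Θ hΘ).hom.hom.hom ≫ e.inv, isMonHom_phiTheta_comp_inv A₀ hΘ D e he,
    fun Ω _ _ s => ?_⟩, rfl, Θ₁, h1,
    isLambdaOfAt_of_cechClass_eq A₀ hΘ D e eP _ rfl _ Θ₁ h2, h2⟩
  obtain ⟨Θs, hamp, hcl⟩ := exists_isAmple_cechClass_eq_fibre A₀ hΘ s
  exact ⟨Θs, hamp, isLambdaOfAt_of_cechClass_eq A₀ hΘ D e eP _ rfl s Θs hcl⟩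

end Literature.AlgebraicGeometry.AbelianVarieties

end
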